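import Mathlib
import Literature.NumberTheory.LFunctions.Zhang2022.SkeletonPartThree
import Literature.NumberTheory.LFunctions.Zhang2022.TypedAppendixB
import Literature.NumberTheory.LFunctions.Zhang2022.SkeletonChiTwist
import Literature.NumberTheory.LFunctions.Zhang2022.SkeletonAlpha1
import Literature.NumberTheory.LFunctions.Zhang2022.AppendixBLemma151Prelims
import Literature.NumberTheory.LFunctions.Zhang2022.AppendixBLemma151Assembly

/-!
# Zhang (2022) Appendix B ⇒ Lemma 15.1: the DED edges into `Skeleton.Lemma151Chi` (rate `α𝓛`) and
# into the reading of record `Skeleton.Lemma151ChiR` (rate `α₁ = α𝓛^{1.1}`)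

Topic `Literature/NumberTheory/LFunctions/Zhang2022` (Landau–Siegel audit tree; verdict-neutral).
Y. Zhang, *Discrete mean estimates and the Landau–Siegel zero*, arXiv:2211.02515v1 (2022)
[Zhang2022LandauSiegel] — **an unrefereed manuscript under adjudication; nothing in this file
asserts any claim of the manuscript.** Cell siegel-zhang (D-0069), DISCHARGE row D16 (cone C37,
Lemma 15.1), DAG node `Z22:Lem15.1.pf` [Z22 App. B pp.106–108, tex L5248–5339]; instances of the
generic assembly `Skeleton.lemma151_assembly_rate` (`AppendixBLemma151Assembly`):

* `rate_alpha_mul_ell`, `rate_alpha1` — the two admissible rates: `α𝓛 = π𝓛⁻⁸` and the cell's `α₁`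
  (SKEL-RULING: `α₁ := α log T = α𝓛^{1.1}`, `Skeleton.alpha1`) lie eventually in `[𝓛⁻⁸, 1]`;
* `lemma151Chi_of_parts` : `EqB_1 → EqB_2 → StepB_mu2 → StepB_mu3 → hmu1 → hdec → Lemma151Chi c′`
  over L4-t10's typed nodes as banked (rate `α𝓛`), and `lemma151Chi_of_typed` with the `μ = 1` input
  taken from `StepB_u012` + `EqB_3` (`hmu1_of_u012_B3`), so that the ONLY hypothesis which is not a
  typed node is `hdec`, the factorisation step absent from the printed proof (GAP row G-d50-1);
* `lemma151ChiR_of_partsR` : the same edge in the `α₁` reading — from `α₁`-form evaluations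
  (`… ≤ C·α₁`, the shapes of the `R` variants of the Appendix-B nodes) to the reading of record
  `Skeleton.Lemma151ChiR c′` (`SkeletonAlpha1`); `lemma151ChiR_of_parts` = the banked-rate inputs also
  give `Lemma151ChiR` (via `lemma151ChiR_of_lemma151Chi`).

WHAT THIS IS NOT: a proof of (B.1)/(B.2), of the residue evaluations, or of the factorisation step;
no claim about Theorems 1–2 or Landau–Siegel zeros. References: Y. Zhang, arXiv:2211.02515v1, §15
Lemma 15.1 (p. 86), App. B (B.1)–(B.3) pp. 106–108. [cite: Zhang2022LandauSiegel, App. B]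
-/

noncomputable section

open Complex Real ComplexConjugate

namespace Literature.NumberTheory.LFunctions.Zhang2022.Skeleton

open Typed.AppendixB (varrhoJ vkSum)

section Rates

/-- `2 ≤ log D` for `D ≥ 8`. [folklore] -/
private theorem two_le_ell_of_eight_le {D : ℕ} (hD : 8 ≤ D) : 2 ≤ ell D := by
  have h8 : (8 : ℝ) ≤ D := by exact_mod_cast hD
  have he2 : Real.exp 2 ≤ 8 := by
    have h : Real.exp 2 = Real.exp 1 * Real.exp 1 := by rw [← Real.exp_add]; norm_num
    rw [h]; nlinarith [Real.exp_one_lt_d9, Real.exp_pos 1]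
  calc (2 : ℝ) = Real.log (Real.exp 2) := (Real.log_exp 2).symm
    _ ≤ Real.log 8 := Real.log_le_log (Real.exp_pos _) he2
    _ ≤ Real.log D := Real.log_le_log (by norm_num) h8

/-- **The rate `α𝓛 = π𝓛⁻⁸` is admissible**: for `D ≥ 8`, `0 < α𝓛 ≤ 1` and `𝓛⁻⁸ ≤ α𝓛`
(`α = π/𝓛⁹`, (2.10), (2.6)). [cite: Zhang2022LandauSiegel, §2 (2.10)] -/
theorem rate_alpha_mul_ell : ∃ D₁ : ℕ, ∀ D : ℕ, D₁ ≤ D →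
    0 < alpha D * ell D ∧ alpha D * ell D ≤ 1 ∧ (ell D ^ 8)⁻¹ ≤ alpha D * ell D := by
  refine ⟨8, fun D hD => ?_⟩
  have hℓ2 := two_le_ell_of_eight_le hD
  have hℓ0 : 0 < ell D := by linarith
  have h9 : alpha D * ell D ^ 9 = π := by
    rw [alpha, bigP, Real.log_exp, div_mul_cancel₀ _ (pow_ne_zero _ hℓ0.ne')]
  have haℓ : alpha D * ell D = π / ell D ^ 8 := by
    rw [eq_div_iff (pow_ne_zero _ hℓ0.ne'), ← h9]; ring
  rw [haℓ]
  refine ⟨by positivity, ?_, ?_⟩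
  · rw [div_le_one (by positivity)]
    calc π ≤ 4 := Real.pi_lt_four.le
      _ ≤ 2 ^ 8 := by norm_num
      _ ≤ ell D ^ 8 := by gcongr
  · rw [le_div_iff₀ (by positivity), inv_mul_cancel₀ (by positivity)]
    linarith [Real.pi_gt_three]

/-- **The rate `α₁ = α log T = α𝓛^{1.1}` is admissible**: for `D ≥ 8`, `0 < α₁ ≤ 1` and `𝓛⁻⁸ ≤ α₁`
(`α𝓛 ≤ α₁`, `Skeleton.alpha_mul_ell_le_alpha1`; `π𝓛^{1.1} ≤ 𝓛⁹`).
[cite: Zhang2022LandauSiegel, §2 (2.10), §6 (`T = exp 𝓛^{1.1}`)] -/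
theorem rate_alpha1 : ∃ D₁ : ℕ, ∀ D : ℕ, D₁ ≤ D →
    0 < alpha1 D ∧ alpha1 D ≤ 1 ∧ (ell D ^ 8)⁻¹ ≤ alpha1 D := by
  obtain ⟨D₁, h₁⟩ := rate_alpha_mul_ell
  refine ⟨max D₁ 8, fun D hD => ?_⟩
  obtain ⟨h0, -, h8⟩ := h₁ D (le_trans (le_max_left _ _) hD)
  have hD8 : 8 ≤ D := le_trans (le_max_right _ _) hD
  have hD3 : 3 ≤ D := le_trans (by norm_num) hD8
  have hle : alpha D * ell D ≤ alpha1 D := alpha_mul_ell_le_alpha1 hD3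
  have hℓ2 := two_le_ell_of_eight_le hD8
  have hℓ1 : 1 ≤ ell D := by linarith
  have hℓ0 : 0 < ell D := by linarith
  refine ⟨lt_of_lt_of_le h0 hle, ?_, h8.trans hle⟩
  -- `α₁ = π𝓛^{1.1}/𝓛⁹ ≤ π𝓛²/𝓛⁹ ≤ 1`
  rw [alpha1, log_bigT, alpha, bigP, Real.log_exp]
  have h11 : ell D ^ (1.1 : ℝ) ≤ ell D ^ 2 := by
    calc ell D ^ (1.1 : ℝ) ≤ ell D ^ (2 : ℝ) := Real.rpow_le_rpow_of_exponent_le hℓ1 (by norm_num)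
      _ = ell D ^ 2 := by norm_cast
  have h7 : π ≤ ell D ^ 7 := by
    calc π ≤ 4 := Real.pi_lt_four.le
      _ ≤ 2 ^ 7 := by norm_num
      _ ≤ ell D ^ 7 := by gcongr
  rw [div_mul_eq_mul_div, div_le_one (pow_pos hℓ0 9)]
  calc π * ell D ^ (1.1 : ℝ) ≤ ell D ^ 7 * ell D ^ 2 := by gcongr
    _ = ell D ^ 9 := by ring

end Rates

/-! ## The edges -/

section Edges

variable (c' : ℝ)

/-- **Lemma 15.1 (`χ`-twisted, `Skeleton.Lemma151Chi c′`) from the Appendix-B nodes as banked**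
(rate `α𝓛`): `EqB_1 → EqB_2 → StepB_mu2 → StepB_mu3 → hmu1 → hdec → Lemma151Chi c′`, where
`hmu1` is the `μ = 1` truncated evaluation and `hdec` the factorisation step (GAP row G-d50-1).
[cite: Zhang2022LandauSiegel, §15 Lemma 15.1; App. B pp. 106–108] -/
theorem lemma151Chi_of_parts
    (hB1 : Typed.AppendixB.EqB_1 c') (hB2 : Typed.AppendixB.EqB_2 c')
    (hmu2 : Typed.AppendixB.StepB_mu2 c') (hmu3 : Typed.AppendixB.StepB_mu3 c')
    (hmu1 : ∃ C : ℝ, ForAllLarge fun D _ _ => ∀ j ∈ ({1, 2, 3} : Finset ℕ), ∀ l₁ : ℕ, 1 ≤ l₁ →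
      l₁ ∈ nset (frakq D) → (l₁ : ℝ) < bigT D →
        ‖vkSum c' D (fun m => if (m : ℝ) < bigP D ^ (1 / 2 : ℝ) then vk1 D m else 0) j l₁ -
            e1j j‖ ≤ C * alpha D * ell D)
    (hdec : ∃ C : ℝ, ForAllLarge fun D _ χ => AssumptionA D χ → ∀ j ∈ ({1, 2, 3} : Finset ℕ),
      ∀ n₁ : ℕ, n₁ ∈ nset (frakq D) → (n₁ : ℝ) < bigT D →
        ‖(∑ n ∈ (Finset.Ico 1 ⌈bigP D⌉₊).filter (fun n => Nat.Coprime n (frakq D)),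
            bcoef D (n₁ * n) * varrhoStar c' χ j n / (n : ℂ)) -
          ∑ p ∈ n₁.divisorsAntidiagonal,
            (∑ u ∈ (Finset.Ico 1 ⌈bigP D⌉₊).filter (fun n => Nat.Coprime n (frakq D)),
              ((if ((p.1 * u : ℕ) : ℝ) < bigP D ^ (1 / 2 : ℝ) then vk1 D (p.1 * u) else 0) +
                iota2 * vk2 D (p.1 * u)) * varrhoStar c' χ j u / (u : ℂ)) *
            (∑ v ∈ (Finset.Ico 1 ⌈bigP D⌉₊).filter (fun n => Nat.Coprime n (frakq D)),
              (conj iota3 * vk3 D (p.2 * v) + conj iota4 * vk2 D (p.2 * v)) *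
                varrhoStar c' χ j v / (v : ℂ))‖ ≤
          C * alpha D * ell D * n₁.divisors.card) :
    Lemma151Chi c' := by
  obtain ⟨C₂, h2⟩ := hmu2
  obtain ⟨C₃, h3⟩ := hmu3
  obtain ⟨C₁, h1⟩ := hmu1
  obtain ⟨C₆, h6⟩ := hdec
  obtain ⟨C, h⟩ := lemma151_assembly_rate c' (fun D => alpha D * ell D) rate_alpha_mul_ell hB1 hB2
    ⟨C₂, h2.mono fun D _ χ _ _ hh j hj l₁ a b c => (hh j hj l₁ a b c).trans (le_of_eq (by ring))⟩
    ⟨C₃, h3.mono fun D _ χ _ _ hh j hj l₁ a b c => (hh j hj l₁ a b c).trans (le_of_eq (by ring))⟩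
    ⟨C₁, h1.mono fun D _ χ _ _ hh j hj l₁ a b c => (hh j hj l₁ a b c).trans (le_of_eq (by ring))⟩
    ⟨C₆, h6.mono fun D _ χ _ _ hh hA j hj n₁ a b => (hh hA j hj n₁ a b).trans (le_of_eq (by ring))⟩
  exact ⟨C, h.mono fun D _ χ _ _ hh hA j hj n₁ a b => (hh hA j hj n₁ a b).trans (le_of_eq (by ring))⟩

/-- **Lemma 15.1 (`χ`-twisted) from the TYPED Appendix-B nodes and the factorisation step alone**:
`EqB_1 → EqB_2 → StepB_mu2 → StepB_mu3 → StepB_u012 → EqB_3 → hdec → Lemma151Chi c′` — the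
`μ = 1` input supplied by `hmu1_of_u012_B3`, so that the only hypothesis that is not a typed node is
`hdec` (GAP row G-d50-1, the reduction step absent from the printed proof).
[cite: Zhang2022LandauSiegel, App. B pp. 106–108] -/
theorem lemma151Chi_of_typed
    (hB1 : Typed.AppendixB.EqB_1 c') (hB2 : Typed.AppendixB.EqB_2 c')
    (hmu2 : Typed.AppendixB.StepB_mu2 c') (hmu3 : Typed.AppendixB.StepB_mu3 c')
    (h12 : Typed.AppendixB.StepB_u012 c') (hB3 : Typed.AppendixB.EqB_3 c')
    (hdec : ∃ C : ℝ, ForAllLarge fun D _ χ => AssumptionA D χ → ∀ j ∈ ({1, 2, 3} : Finset ℕ),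
      ∀ n₁ : ℕ, n₁ ∈ nset (frakq D) → (n₁ : ℝ) < bigT D →
        ‖(∑ n ∈ (Finset.Ico 1 ⌈bigP D⌉₊).filter (fun n => Nat.Coprime n (frakq D)),
            bcoef D (n₁ * n) * varrhoStar c' χ j n / (n : ℂ)) -
          ∑ p ∈ n₁.divisorsAntidiagonal,
            (∑ u ∈ (Finset.Ico 1 ⌈bigP D⌉₊).filter (fun n => Nat.Coprime n (frakq D)),
              ((if ((p.1 * u : ℕ) : ℝ) < bigP D ^ (1 / 2 : ℝ) then vk1 D (p.1 * u) else 0) +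
                iota2 * vk2 D (p.1 * u)) * varrhoStar c' χ j u / (u : ℂ)) *
            (∑ v ∈ (Finset.Ico 1 ⌈bigP D⌉₊).filter (fun n => Nat.Coprime n (frakq D)),
              (conj iota3 * vk3 D (p.2 * v) + conj iota4 * vk2 D (p.2 * v)) *
                varrhoStar c' χ j v / (v : ℂ))‖ ≤
          C * alpha D * ell D * n₁.divisors.card) :
    Lemma151Chi c' :=
  lemma151Chi_of_parts c' hB1 hB2 hmu2 hmu3 (hmu1_of_u012_B3 c' h12 hB3) hdec

/-- The banked-rate inputs also give the reading of record `Skeleton.Lemma151ChiR` (`α𝓛 ≤ α₁`,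
`lemma151ChiR_of_lemma151Chi`). [cite: Zhang2022LandauSiegel, §15 Lemma 15.1] -/
theorem lemma151ChiR_of_typed
    (hB1 : Typed.AppendixB.EqB_1 c') (hB2 : Typed.AppendixB.EqB_2 c')
    (hmu2 : Typed.AppendixB.StepB_mu2 c') (hmu3 : Typed.AppendixB.StepB_mu3 c')
    (h12 : Typed.AppendixB.StepB_u012 c') (hB3 : Typed.AppendixB.EqB_3 c')
    (hdec : ∃ C : ℝ, ForAllLarge fun D _ χ => AssumptionA D χ → ∀ j ∈ ({1, 2, 3} : Finset ℕ),
      ∀ n₁ : ℕ, n₁ ∈ nset (frakq D) → (n₁ : ℝ) < bigT D →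
        ‖(∑ n ∈ (Finset.Ico 1 ⌈bigP D⌉₊).filter (fun n => Nat.Coprime n (frakq D)),
            bcoef D (n₁ * n) * varrhoStar c' χ j n / (n : ℂ)) -
          ∑ p ∈ n₁.divisorsAntidiagonal,
            (∑ u ∈ (Finset.Ico 1 ⌈bigP D⌉₊).filter (fun n => Nat.Coprime n (frakq D)),
              ((if ((p.1 * u : ℕ) : ℝ) < bigP D ^ (1 / 2 : ℝ) then vk1 D (p.1 * u) else 0) +
                iota2 * vk2 D (p.1 * u)) * varrhoStar c' χ j u / (u : ℂ)) *
            (∑ v ∈ (Finset.Ico 1 ⌈bigP D⌉₊).filter (fun n => Nat.Coprime n (frakq D)),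
              (conj iota3 * vk3 D (p.2 * v) + conj iota4 * vk2 D (p.2 * v)) *
                varrhoStar c' χ j v / (v : ℂ))‖ ≤
          C * alpha D * ell D * n₁.divisors.card) :
    Lemma151ChiR c' :=
  lemma151ChiR_of_lemma151Chi (lemma151Chi_of_typed c' hB1 hB2 hmu2 hmu3 h12 hB3 hdec)

/-- **Lemma 15.1 in the reading of record (`Skeleton.Lemma151ChiR c′`, rate `α₁ = α𝓛^{1.1}`) from
`α₁`-form Appendix-B evaluations** — the edge to use once the one-variable evaluations are discharged
only at the rate `O(α₁)` (cell ruling `α₁ := α log T`; e.g. `log P₂ = 0.5 log P − 10𝓛^{1.1}`): the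
`μ = 2, 3` evaluations, the `μ = 1` truncated evaluation and the factorisation step with error
`C·α₁`, plus (B.1), (B.2). [cite: Zhang2022LandauSiegel, §15 Lemma 15.1; App. B pp. 106–108] -/
theorem lemma151ChiR_of_partsR
    (hB1 : Typed.AppendixB.EqB_1 c') (hB2 : Typed.AppendixB.EqB_2 c')
    (hmu2 : ∃ C : ℝ, ForAllLarge fun D _ _ => ∀ j ∈ ({1, 2, 3} : Finset ℕ), ∀ l₁ : ℕ, 1 ≤ l₁ →
      l₁ ∈ nset (frakq D) → (l₁ : ℝ) < bigT D → ‖vkSum c' D (vk2 D) j l₁ - e2j j‖ ≤ C * alpha1 D)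
    (hmu3 : ∃ C : ℝ, ForAllLarge fun D _ _ => ∀ j ∈ ({1, 2, 3} : Finset ℕ), ∀ l₁ : ℕ, 1 ≤ l₁ →
      l₁ ∈ nset (frakq D) → (l₁ : ℝ) < bigT D → ‖vkSum c' D (vk3 D) j l₁ - e3j j‖ ≤ C * alpha1 D)
    (hmu1 : ∃ C : ℝ, ForAllLarge fun D _ _ => ∀ j ∈ ({1, 2, 3} : Finset ℕ), ∀ l₁ : ℕ, 1 ≤ l₁ →
      l₁ ∈ nset (frakq D) → (l₁ : ℝ) < bigT D →
        ‖vkSum c' D (fun m => if (m : ℝ) < bigP D ^ (1 / 2 : ℝ) then vk1 D m else 0) j l₁ -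
            e1j j‖ ≤ C * alpha1 D)
    (hdec : ∃ C : ℝ, ForAllLarge fun D _ χ => AssumptionA D χ → ∀ j ∈ ({1, 2, 3} : Finset ℕ),
      ∀ n₁ : ℕ, n₁ ∈ nset (frakq D) → (n₁ : ℝ) < bigT D →
        ‖(∑ n ∈ (Finset.Ico 1 ⌈bigP D⌉₊).filter (fun n => Nat.Coprime n (frakq D)),
            bcoef D (n₁ * n) * varrhoStar c' χ j n / (n : ℂ)) -
          ∑ p ∈ n₁.divisorsAntidiagonal,
            (∑ u ∈ (Finset.Ico 1 ⌈bigP D⌉₊).filter (fun n => Nat.Coprime n (frakq D)),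
              ((if ((p.1 * u : ℕ) : ℝ) < bigP D ^ (1 / 2 : ℝ) then vk1 D (p.1 * u) else 0) +
                iota2 * vk2 D (p.1 * u)) * varrhoStar c' χ j u / (u : ℂ)) *
            (∑ v ∈ (Finset.Ico 1 ⌈bigP D⌉₊).filter (fun n => Nat.Coprime n (frakq D)),
              (conj iota3 * vk3 D (p.2 * v) + conj iota4 * vk2 D (p.2 * v)) *
                varrhoStar c' χ j v / (v : ℂ))‖ ≤
          C * alpha1 D * n₁.divisors.card) :
    Lemma151ChiR c' :=
  lemma151_assembly_rate c' alpha1 rate_alpha1 hB1 hB2 hmu2 hmu3 hmu1 hdec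

end Edges

end Literature.NumberTheory.LFunctions.Zhang2022.Skeleton
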